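import Literature.AlgebraicGeometry.FundamentalGroup.RiemannExistenceZariskiLocal
import Literature.AlgebraicGeometry.FundamentalGroup.RiemannExistenceEtaleLocalHomeomorph
import HarnessLib

/-!
# A finite étale cover of an open subscheme is a covering map over the open's complex points

Topic `Literature/AlgebraicGeometry/FundamentalGroup`; theorems only (no definition, no named fact).
The tree proves that the map on complex points of a finite étale morphism of separated
`ℂ`-schemes is a finite covering map (`isCoveringMap_map_of_isFinite_of_etale_of_isSeparated`,
SGA1 XII Thm. 5.1 with Prop. 3.1 (iii) and 3.2 (vi)) and packages the complex points of an open
subscheme `X|_U` as the subset `{P | P ∈ U}` of `X(ℂ)` (`ZariskiLocal.pointsHomeomorph`,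
`RiemannExistenceZariskiLocal`). This file combines the two in the shape used by monodromy
arguments over a Zariski open part of a base ("a finite étale cover of `S ∖ Z`"): for a finite étale
`g₀ : Y ⟶ X|_U`, the composite `Y(ℂ) → X(ℂ)` is a covering map OVER the open subset `U(ℂ) ⊆ X(ℂ)`
in Mathlib's sense `IsCoveringMapOn`, with finite fibres over `U(ℂ)` — so that paths of `X(ℂ)`
inside `U(ℂ)` lift to `Y(ℂ)` (`IsCoveringMapOn.isCoveringMap_restrictPreimage` and Mathlib's path
lifting).

* `ZariskiLocal.isOpen_setOf_pt_mem` — `{P ∈ X(ℂ) | P ∈ U}` is open (range of the open embedding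
  `U(ℂ) ↪ X(ℂ)`, SGA1 XII Prop. 3.1 (xi));
* `ZariskiLocal.isCoveringMapOn_map_comp_openSubschemeOverι` — **`Y(ℂ) → X(ℂ)` is a covering map
  over `U(ℂ)`** for `Y ⟶ X|_U` finite étale, `X` separated over `ℂ`;
* `ZariskiLocal.finite_preimage_map_comp_openSubschemeOverι` — its fibres are finite.

## References

* [SGA1] A. Grothendieck, M. Raynaud, SGA 1, Exp. XII Thm. 5.1, Prop. 3.1 (iii), (xi), Prop. 3.2 (vi).
* [HatcherAT2002] A. Hatcher, Algebraic Topology, CUP 2002, §1.3.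

#harness_tags fundamental_group.riemann_existence, hodge.monodromy
-/

noncomputable section

open CategoryTheory AlgebraicGeometry
open _root_.Topology

namespace Literature.AlgebraicGeometry.FundamentalGroup

open Literature.AlgebraicGeometry.Motives Literature.AlgebraicGeometry.Motives.AlgPoints

namespace ZariskiLocal

variable {X Y : Motives.SchemeOver ℂ} (U : X.left.Opens)

/-- The complex points of `X` lying in the Zariski open `U` form an open subset of `X(ℂ)` (the range
of the open embedding `U(ℂ) ↪ X(ℂ)`). [cite: SGA1, Exp. XII Prop. 3.1 (xi)] -/
theorem isOpen_setOf_pt_mem : IsOpen {P : Motives.ComplexPoints X | P.pt ∈ U} := by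
  rw [← range_map_openSubschemeOverι X U]
  exact (AlgPoints.isOpenEmbedding_map_holds (openSubschemeOverι X U)).isOpen_range

/-- A complex point of `Y` maps into `U(ℂ)` under `Y ⟶ X|_U ⟶ X`. [folklore] -/
theorem pt_map_comp_openSubschemeOverι_mem (g₀ : Y ⟶ openSubschemeOver X U)
    (z : Motives.ComplexPoints Y) : (AlgPoints.map (g₀ ≫ openSubschemeOverι X U) z).pt ∈ U := by
  rw [AlgPoints.map_comp_apply]
  exact (pointsHomeomorph X U (AlgPoints.map g₀ z)).2

/-- **A finite étale cover of the open subscheme `X|_U` is a covering map over `U(ℂ)`.** For `X`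
separated over `ℂ` and `g₀ : Y ⟶ X|_U` finite étale, the map on complex points of
`Y ⟶ X|_U ⟶ X` is a covering map over the open subset `{P | P ∈ U}` of `X(ℂ)`: `Y(ℂ) → (X|_U)(ℂ)` is
a covering map (SGA1 XII 5.1 / Prop. 3.2 (vi), the tree's
`isCoveringMap_map_of_isFinite_of_etale_of_isSeparated`), `(X|_U)(ℂ) ≃ₜ {P | P ∈ U}`
(`pointsHomeomorph`), and a covering map onto an open subset is a covering map over it
(`IsCoveringMapOn.of_isCoveringMap_subtype`). [cite: SGA1, Exp. XII Thm. 5.1 and Prop. 3.2 (vi)] -/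
theorem isCoveringMapOn_map_comp_openSubschemeOverι [IsSeparated X.hom]
    (g₀ : Y ⟶ openSubschemeOver X U) [IsFinite g₀.left] [Etale g₀.left] :
    IsCoveringMapOn
      (AlgPoints.map (g₀ ≫ openSubschemeOverι X U) : Motives.ComplexPoints Y → Motives.ComplexPoints X)
      {P | P.pt ∈ U} := by
  haveI : IsSeparated (openSubschemeOver X U).hom := inferInstanceAs (IsSeparated (U.ι ≫ X.hom))
  have hcov := (isCoveringMap_map_of_isFinite_of_etale_of_isSeparated g₀).1
  refine IsCoveringMapOn.of_isCoveringMap_subtype (isOpen_setOf_pt_mem U)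
    (pt_map_comp_openSubschemeOverι_mem U g₀) ?_
  have heq : (fun z ↦ (⟨AlgPoints.map (g₀ ≫ openSubschemeOverι X U) z,
      pt_map_comp_openSubschemeOverι_mem U g₀ z⟩ : {P : Motives.ComplexPoints X | P.pt ∈ U})) =
      pointsHomeomorph X U ∘ AlgPoints.map g₀ := by
    funext z
    apply Subtype.ext
    simp only [Function.comp_apply, pointsHomeomorph_apply_coe, AlgPoints.map_comp_apply]
  rw [heq]
  exact hcov.homeomorph_comp _

/-- The fibres of `Y(ℂ) → X(ℂ)` are finite, for `g₀ : Y ⟶ X|_U` finite étale (`X` separated).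
[cite: SGA1, Exp. XII Prop. 3.2 (vi)] -/
theorem finite_preimage_map_comp_openSubschemeOverι [IsSeparated X.hom]
    (g₀ : Y ⟶ openSubschemeOver X U) [IsFinite g₀.left] [Etale g₀.left]
    (P : Motives.ComplexPoints X) :
    ((AlgPoints.map (g₀ ≫ openSubschemeOverι X U) :
      Motives.ComplexPoints Y → Motives.ComplexPoints X) ⁻¹' {P}).Finite := by
  haveI : IsSeparated (openSubschemeOver X U).hom := inferInstanceAs (IsSeparated (U.ι ≫ X.hom))
  by_cases hP : P.pt ∈ U
  · have hfin := (isCoveringMap_map_of_isFinite_of_etale_of_isSeparated g₀).2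
      ((pointsHomeomorph X U).symm ⟨P, hP⟩)
    refine hfin.subset fun z hz ↦ ?_
    rw [Set.mem_preimage, Set.mem_singleton_iff] at hz ⊢
    apply (pointsHomeomorph X U).injective
    apply Subtype.ext
    rw [Homeomorph.apply_symm_apply, pointsHomeomorph_apply_coe, ← AlgPoints.map_comp_apply, hz]
  · convert Set.finite_empty
    ext z
    simp only [Set.mem_preimage, Set.mem_singleton_iff, Set.mem_empty_iff_false, iff_false]
    intro hz
    exact hP (hz ▸ pt_map_comp_openSubschemeOverι_mem U g₀ z)

end ZariskiLocal

end Literature.AlgebraicGeometry.FundamentalGroup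

end
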